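import Mathlib
import HarnessLib
import Literature.MathematicalPhysics.QuantumLattice.FermiRG.BGM2006AppA3Reduction
import Summits.HubbardSuperconductivity.HubbardSuperconductivity.Theorems.KLProgrammeH10TwoPointLimitKlAnisoSupportChart
import Summits.HubbardSuperconductivity.HubbardSuperconductivity.Theorems.KLProgrammeH10TwoPointLimitKlAnisoAncestor
import Summits.HubbardSuperconductivity.HubbardSuperconductivity.Theorems.KLProgrammeH10TwoPointLimitKlAnisoOffUmklappCountAllScales
import Summits.HubbardSuperconductivity.HubbardSuperconductivity.Theorems.KLProgrammeKLRegimeSplitConsts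
import Summits.HubbardSuperconductivity.HubbardSuperconductivity.Theorems.KLProgrammeH10TwoPointLimitKlAnisoCentreTransfer
import Summits.HubbardSuperconductivity.HubbardSuperconductivity.Theorems.KLProgrammeH10TwoPointLimitFrameBGM2003SectorCountingTargetWidePrescribedUniform

/-!
# Route `KLProgramme` — K3 engine (stmt-HubbardSuperconductivity-20437), stub (b) (ℓ)/(I2), item (R) «redundant-class graded count» (pen (R98)):
# the keyed OFF-CLASS relative count with a SET `E` of prescribed fine legs, exponent `(m+1) − |E| − 2`, WIDE free bundle

Cell gate-hubbard-kl, seat p4 g14 (memos HOME/prover-p4/TWO-ANCHOR-FALSE.md, KEYED-R1-NOTE.md §6, TIGHT-RELCOUNT-LAW.md §5).  The landed keyed off-class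
row «KEYED-R1» (`card_relCount_prescribed_offUmklapp_klAniso_le_frame_allScales`, p591304) has exponent `(m+1) − 3` for EVERY prescribed set `E ∋ p`: a second
prescribed fine leg gains nothing, and on the TIGHT redundant class (all free legs within one coarse sector, the prescribed legs far away) that is the truth
(TWO-ANCHOR-FALSE).  On the GRADED redundant class — two FREE legs `i₀, j₀ ∉ E` whose sign-absorbed coarse centres are more than `Θ + 5w_k` apart — every
prescribed leg beyond the first DOES gain a full `3·2^{J′−k}`: this file proves
`card_relCount_prescribed_offUmklapp_klAniso_le_frame_widePrescribed`: `#{σ″ ∈ A″ : σ″|_E = τ″|_E, σ″ refines σ′ leg by leg} ≤ 5^{m+1}·(m+1)²·B_fib·(3·2^{J′−k})^{(m+1)−|E|−2}`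
for `σ′` OFF the umklapp-active class (g12's all-scales splitter: the refinements conserve momentum in `ℝ²`), `|E| + 3 ≤ m + 1`, the prescribed legs within `Ψ₀`
(mod `π`, signs absorbed) of the free ones at the coarse scale, and the regime / fibre constant of `BGM2003.count_target_wide_prescribed` (Lit p608507; frame-uniform
twin p608962) with `L_Ψ = (m+1) + c₂·|E|·(Ψ₀ + 5w_k)/(K₁Θ)` — the transversality of the prescribed legs is paid in `L_Ψ` (loss `(1 + c₂|E|Ψ/(K₁(m+1)Θ))²`),
exactly as the pinned leg's is on the umklapp class (memo TIGHT-RELCOUNT-LAW §3: same geometry, the far prescribed legs' windows play the transversal pin).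
Proof = g13's keyed wide assembly (`…KlAnisoOnUmklappCountWide`, p599408) with the off-class splitter and the prescribed-set count.
Everything is PROVED; no definitions, no named facts; nothing here asserts anything about the model or superconductivity.
References: BGM 2006 App. A3 [cite: BenfattoGiulianiMastropietro2006]; BGM 2003 §3.1 Lemma 3.1 (4.3), §7.4 [cite: BenfattoGiulianiMastropietro2003].
-/

noncomputable section

namespace Summit.HubbardSuperconductivity.HubbardSuperconductivity.Theorems.PerturbedFermiCurve

set_option linter.dupNamespace false -- summit = problem name (single-conjunct summit), D-0017

open Classical
open Real Set Finset
open Literature.MathematicalPhysics.QuantumLattice Literature.MathematicalPhysics.QuantumLattice.BandSectorCounting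
open Literature.MathematicalPhysics.QuantumLattice.FermiRG Literature.MathematicalPhysics.QuantumLattice.FermiRG.BGM2003
open Literature.MathematicalPhysics.QuantumLattice.FermiRG.BGM2006AppA (signedMom_mem_sSector2003 sSector2003_subset_of_le)
open Literature.Probability.LatticeModels
open Summit.HubbardSuperconductivity.HubbardSuperconductivity.Theorems.DispersionFlow
open Summit.HubbardSuperconductivity.HubbardSuperconductivity.Theorems.KLRegimeSplit
open Summit.HubbardSuperconductivity.HubbardSuperconductivity.Theorems.KLProgrammeLegKernels
open Summit.HubbardSuperconductivity.HubbardSuperconductivity.Theorems.TorusFourierL2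

/-! ## The keyed OFF-CLASS relative count with a prescribed SET of fine legs, WIDE free bundle (two free coarse legs at sign-absorbed angle `> Θ + 5w_k`) -/

/-- **The keyed OFF-CLASS relative count with a SET of prescribed fine legs, WIDE free bundle** («(R)», graded redundant class).  For every level window with
`-4 < μ₁ − 4·klE0`, `μ₂ + 4·klE0 < 0` there are `κ, C > 0` and geometric constants `c₂ ≥ 0`, `cb, K₁, K₂, c₀, c₂′ > 0` (`2 + c₂ ≤ K₁`) such that for every frame `K`
with `4A ≤ κ`, `μ ∈ [μ₁, μ₂]`, torus `L`, cutoff `M`, `β`, `m + 1 ≥ 4` legs, scales `k ≤ J′`, every `A″ ⊆ bgmSectorSet`, prescribed legs `E` (`|E| + 3 ≤ m + 1`) with labels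
`τ″|_E`, every coarse tuple `σ′` OFF the umklapp-active class (tolerance `(m+1)·C·w_k`) whose prescribed legs are within `Ψ₀` (mod `π`, signs absorbed) of its free
legs, every regime parameter `Θ` / fibre constant `B_fib` of `BGM2003.count_target_wide_prescribed` at wedge `Ψ₀ + 5w_k`, and two FREE legs `i₀, j₀ ∉ E` whose
sign-absorbed coarse centres are more than `Θ + 5w_k` apart:
`#{σ″ ∈ A″ : σ″|_E = τ″|_E, σ″ refines σ′ leg by leg} ≤ 5^{m+1}·(m+1)²·B_fib·(3·2^{J′−k})^{(m+1)−|E|−2}`.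
[cite: BenfattoGiulianiMastropietro2006, App. A3 Lemma A3.1; BenfattoGiulianiMastropietro2003, §3.1 Lemma 3.1 (4.3), §7.4] -/
theorem card_relCount_prescribed_offUmklapp_klAniso_le_frame_widePrescribed :
    ∀ μ₁ μ₂ : ℝ, -4 < μ₁ - 4 * klE0 → μ₁ ≤ μ₂ → μ₂ + 4 * klE0 < 0 →
      ∃ κ : ℝ, 0 < κ ∧ ∃ C : ℝ, 0 < C ∧
      ∃ c₂ cb K₁ K₂ c₀ c₂' : ℝ, 0 ≤ c₂ ∧ 0 < cb ∧ 2 + c₂ ≤ K₁ ∧ 0 < K₂ ∧ 0 < c₀ ∧ 0 < c₂' ∧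
      ∀ (K : TrigPolyC4v) (A : ℝ), (∀ p : Momentum, ∀ j ≤ 2, ‖iteratedFDeriv ℝ j (frameShift K) p‖ ≤ A) → 4 * A ≤ κ →
      ∀ μ ∈ Set.Icc μ₁ μ₂, ∀ (L M : ℕ) [NeZero L] (β : ℝ) (m k J' : ℕ), k ≤ J' →
      ∀ (A'' : Finset (Fin (m + 1) → SectorLeg (sectorCount J'))),
        A'' ⊆ bgmSectorSet L M (klAnisoFamily L M β μ K klE0 J') (m + 1) →
      ∀ (E : Finset (Fin (m + 1))), E.card + 3 ≤ m + 1 → ∀ (τ'' : Fin (m + 1) → SectorLeg (sectorCount J')),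
      ∀ σ' : Fin (m + 1) → SectorLeg (sectorCount k),
      (∀ G : Fin 2 → ℤ, G ≠ 0 → ∃ j : Fin 2, ((m : ℝ) + 1) * C * sectorWidth k <
          |∑ i, (if (σ' i).2 = 0 then klFermiPoint μ K (sectorCenter k (σ' i).1.1) j
              else -klFermiPoint μ K (sectorCenter k (σ' i).1.1) j) - 2 * π * (G j : ℝ)|) →
      ∀ Ψ₀ : ℝ, 0 ≤ Ψ₀ →
      (∀ e ∈ E, ∀ i : Fin (m + 1), i ∉ E → pairAngle
          (sectorCenter k (if (σ' e).2 = 0 then ((σ' e).1.1 : ℕ) else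
            if ((σ' e).1.1 : ℕ) < 2 ^ k then ((σ' e).1.1 : ℕ) + 2 ^ k else ((σ' e).1.1 : ℕ) - 2 ^ k))
          (sectorCenter k (if (σ' i).2 = 0 then ((σ' i).1.1 : ℕ) else
            if ((σ' i).1.1 : ℕ) < 2 ^ k then ((σ' i).1.1 : ℕ) + 2 ^ k else ((σ' i).1.1 : ℕ) - 2 ^ k)) ≤ Ψ₀) →
      ∀ (Θ LΨ Bfib : ℝ), LΨ = (m + 1 : ℕ) + c₂ * (E.card * (Ψ₀ + 5 * sectorWidth k)) / (K₁ * Θ) → (2 : ℝ) ^ (-(J' : ℤ)) ≤ Θ →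
        cb * (2 : ℝ) ^ (-(J' : ℤ)) ≤ Θ → K₂ * LΨ * (cb * (2 : ℝ) ^ (-(J' : ℤ))) ≤ c₂' * Θ →
        max ((2 * ((2 * c₀ * K₂ * cb / π + 1) * LΨ)) ^ 2) (4 * cb ^ 2 * K₂ ^ 2 / 1 ^ 2 * LΨ ^ 2) ≤ Bfib →
      ∀ (i₀ j₀ : Fin (m + 1)), i₀ ∉ E → j₀ ∉ E →
      Θ + 5 * sectorWidth k < pairAngle
          (sectorCenter k (if (σ' i₀).2 = 0 then ((σ' i₀).1.1 : ℕ) else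
            if ((σ' i₀).1.1 : ℕ) < 2 ^ k then ((σ' i₀).1.1 : ℕ) + 2 ^ k else ((σ' i₀).1.1 : ℕ) - 2 ^ k))
          (sectorCenter k (if (σ' j₀).2 = 0 then ((σ' j₀).1.1 : ℕ) else
            if ((σ' j₀).1.1 : ℕ) < 2 ^ k then ((σ' j₀).1.1 : ℕ) + 2 ^ k else ((σ' j₀).1.1 : ℕ) - 2 ^ k)) →
      ((((A''.filter fun σ'' => (∀ e ∈ E, σ'' e = τ'' e) ∧ ∀ i,
          (∃ q : FreqMomentum L M, klAnisoFamily L M β μ K klE0 J' (σ'' i).1.1 q ≠ 0 ∧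
            bgmFatMultiplier L M klE0 β (nambuXiCT L μ K) k (σ' i).1.1 q ≠ 0) ∧
          (σ' i).1.2 = (σ'' i).1.2 ∧ (σ' i).2 = (σ'' i).2).card : ℕ) : ℝ)) ≤
        (5 : ℝ) ^ (m + 1) * ((m + 1 : ℕ) ^ 2 * (Bfib * (3 * (2 : ℝ) ^ (J' - k)) ^ ((m + 1) - E.card - 2))) := by
  intro μ₁ μ₂ hμ₁ h12 hμ₂
  have he0 : (0 : ℝ) < klE0 := by norm_num [klE0]
  -- the band constants on the enlarged window (for the support-to-chart dictionary)
  have hab : μ₁ - 4 * klE0 ≤ μ₂ + 4 * klE0 := by linarith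
  obtain ⟨B, -⟩ : ∃ B : BandBounds (μ₁ - 4 * klE0) (μ₂ + 4 * klE0), B = bandBounds hμ₁ hab hμ₂ := ⟨_, rfl⟩
  have hDt := B.Dtmin_pos
  -- the OFF-CLASS splitter (all scales) and the frame-uniform Lemma 3.1 WITH TARGET and PRESCRIBED SET, shell `klE0`
  obtain ⟨κs, hκs, C, hC, hsplit⟩ := sum_signedReps_eq_zero_of_offUmklapp_frame_allScales μ₁ μ₂ hμ₁ h12 hμ₂
  obtain ⟨κc, hκc, c₂, cb, K₁, K₂, c₀, c₂', hc₂, hcb, hK₁, hK₂, hc₀, hc₂', hcount⟩ :=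
    frame_bgm2003_sectorCountingTargetWidePrescribed_uniform_shell μ₁ μ₂ klE0 he0 hμ₁ h12 hμ₂
  obtain ⟨κ, hκdef⟩ : ∃ κ : ℝ, κ = min κs (min κc (min B.Dtmin klE0)) := ⟨_, rfl⟩
  have hκ0 : 0 < κ := by rw [hκdef]; exact lt_min hκs (lt_min hκc (lt_min hDt he0))
  have hκ1 : κ ≤ κs := by rw [hκdef]; exact min_le_left _ _
  have hκ2 : κ ≤ κc := by rw [hκdef]; exact (min_le_right _ _).trans (min_le_left _ _)
  have hκ3 : κ ≤ B.Dtmin := by rw [hκdef]; exact (min_le_right _ _).trans ((min_le_right _ _).trans (min_le_left _ _))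
  have hκ4 : κ ≤ klE0 := by rw [hκdef]; exact (min_le_right _ _).trans ((min_le_right _ _).trans (min_le_right _ _))
  refine ⟨κ, hκ0, C, hC, c₂, cb, K₁, K₂, c₀, c₂', hc₂, hcb, hK₁, hK₂, hc₀, hc₂', ?_⟩
  intro K A hA hAκ μ hμ L M _ β m k J' hkJ A'' hA'' E hEL τ'' σ' hoff Ψ₀ hΨ₀ hwedge Θ LΨ Bfib hLΨ hΘt hΘδ hΘη hBfib i₀ j₀ hi₀ hj₀ hfar
  have hA0 : 0 ≤ A := le_trans (norm_nonneg _) (hA 0 0 (by norm_num))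
  have hADt : 2 * A < B.Dtmin := by linarith
  have hlo : μ₁ - 4 * klE0 ≤ μ - A - klE0 := by linarith [hμ.1]
  have hhi : μ + A + klE0 ≤ μ₂ + 4 * klE0 := by linarith [hμ.2]
  have hNpos : 0 < sectorCount k := sectorCount_pos k
  -- the fine wedge
  have hw0 : 0 ≤ sectorWidth k := (sectorWidth_pos k).le
  have hΨ : 0 ≤ Ψ₀ + 5 * sectorWidth k := by positivity
  -- notation
  set u : ℝ → ℝ → ℝ := fun ϑ e => perturbedFermiRadius (fun q : Fin 2 → ℝ => frameShift K (WithLp.toLp 2 q)) (μ + e) ϑ with hu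
  have hanti : ∀ θ e : ℝ, |e| ≤ klE0 → u (θ + π) e = u θ e := fun θ e _ =>
    perturbedFermiRadius_add_pi (frameShift_toLp_neg K) (μ + e) θ
  set S := A''.filter fun σ'' => (∀ e ∈ E, σ'' e = τ'' e) ∧ ∀ i,
      (∃ q : FreqMomentum L M, klAnisoFamily L M β μ K klE0 J' (σ'' i).1.1 q ≠ 0 ∧
        bgmFatMultiplier L M klE0 β (nambuXiCT L μ K) k (σ' i).1.1 q ≠ 0) ∧
      (σ' i).1.2 = (σ'' i).1.2 ∧ (σ' i).2 = (σ'' i).2 with hSdef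
  -- the half-turn index map and the signed fine string of a label tuple
  set hti : ℕ → Bool → ℕ → ℕ := fun n s j => if s then j else if j < 2 ^ n then j + 2 ^ n else j - 2 ^ n with hhti
  have hti_lt : ∀ (n : ℕ) (s : Bool) {j : ℕ}, j < sectorCount n → hti n s j < sectorCount n :=
    fun n s j hj => halfTurnIdx_lt s hj
  set Φ : (Fin (m + 1) → SectorLeg (sectorCount J')) → (Fin (m + 1) → Fin (sectorCount J')) :=
    fun σ'' i => ⟨hti J' (decide ((σ'' i).2 = 0)) (σ'' i).1.1, hti_lt J' _ (σ'' i).1.1.isLt⟩ with hΦ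
  -- the prescribed fine chart labels (legs of `E`) and the ancestor string map
  set τc : Fin (m + 1) → Fin (sectorCount J') :=
    fun e => ⟨hti J' (decide ((τ'' e).2 = 0)) (τ'' e).1.1, hti_lt J' _ (τ'' e).1.1.isLt⟩ with hτc
  set f : (Fin (m + 1) → SectorLeg (sectorCount J')) → (Fin (m + 1) → Fin (sectorCount k)) :=
    fun σ'' i => ⟨((Φ σ'' i : Fin (sectorCount J')) : ℕ) / 2 ^ (J' - k), div_pow_lt_sectorCount hkJ (Φ σ'' i).isLt⟩ with hf
  -- the candidate coarse strings: `≤ 5` ancestors per leg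
  set T : (Fin (m + 1) → Fin 5) → (Fin (m + 1) → Fin (sectorCount k)) := fun dv i =>
    ⟨hti k (decide ((σ' i).2 = 0))
        ((((((σ' i).1.1 : ℕ) : ℤ) + ((dv i : ℕ) : ℤ) - 2) % (sectorCount k : ℤ)).toNat),
      hti_lt k _ (toNat_emod_lt hNpos _)⟩ with hT
  -- (1) COVER: the ancestor string of every `σ″ ∈ S` is a candidate
  have hcover : ∀ σ'' ∈ S, f σ'' ∈ (univ : Finset (Fin (m + 1) → Fin 5)).image T := by
    intro σ'' hσ''
    rw [hSdef, mem_filter] at hσ''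
    obtain ⟨-, -, hleg⟩ := hσ''
    have hD : ∀ i, ∃ D : ℤ, |D| ≤ 2 ∧ (sectorCount k : ℤ) ∣
        (((((σ'' i).1.1 : ℕ) / 2 ^ (J' - k) : ℕ) : ℤ) - (((σ' i).1.1 : ℕ) : ℤ) - D) := by
      intro i
      obtain ⟨⟨q, hq, hq'⟩, -, -⟩ := hleg i
      exact exists_ancestor_near_of_overlap L M he0 hkJ hq hq'
    choose Df hDf using hD
    refine mem_image.2 ⟨fun i => ⟨(Df i + 2).toNat, by have := (abs_le.1 (hDf i).1); omega⟩, mem_univ _, ?_⟩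
    funext i
    obtain ⟨hDabs, hDdvd⟩ := hDf i
    obtain ⟨-, hspin, hch⟩ := hleg i
    apply Fin.ext
    simp only [hT, hf, hΦ]
    have h2 : (((Df i + 2).toNat : ℕ) : ℤ) = Df i + 2 := by have := (abs_le.1 hDabs); omega
    rw [h2, show (((σ' i).1.1 : ℕ) : ℤ) + (Df i + 2) - 2 = (((σ' i).1.1 : ℕ) : ℤ) + Df i by ring]
    -- the ancestor IS the representative of `ω′ + D`
    have hanc : ((σ'' i).1.1 : ℕ) / 2 ^ (J' - k) = (((((σ' i).1.1 : ℕ) : ℤ) + Df i) % (sectorCount k : ℤ)).toNat :=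
      eq_toNat_emod_of_dvd hNpos (div_pow_lt_sectorCount hkJ (σ'' i).1.1.isLt) (by
        have e : ((((σ'' i).1.1 : ℕ) / 2 ^ (J' - k) : ℕ) : ℤ) - ((((σ' i).1.1 : ℕ) : ℤ) + Df i) =
            ((((σ'' i).1.1 : ℕ) / 2 ^ (J' - k) : ℕ) : ℤ) - (((σ' i).1.1 : ℕ) : ℤ) - Df i := by ring
        rw [e]; exact hDdvd)
    rw [← hanc, hch]
    simp only [hhti]
    exact (halfTurnIdx_div hkJ _ (σ'' i).1.1.isLt).symm
  -- (2) FIBRES: for a candidate coarse string `t`, the `σ″ ∈ S` with ancestor string `t` inject into BGM 2003's sector strings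
  -- the TARGET string set of a candidate coarse string
  set Str : (Fin (m + 1) → Fin (sectorCount k)) → Set (Fin (m + 1) → Fin (sectorCount J')) := fun t =>
    {ω : Fin (m + 1) → Fin (sectorCount J') |
      (∀ e ∈ E, ω e = τc e) ∧ (∀ i' : Fin (m + 1), i' ∉ E → sSector u klE0 J' (ω i' : ℕ) ⊆ sSector u klE0 k (t i' : ℕ)) ∧
      (∀ e ∈ E, ∀ m' : Fin (m + 1), m' ∉ E → pairAngle (sectorCenter J' (ω e)) (sectorCenter J' (ω m')) ≤ Ψ₀ + 5 * sectorWidth k) ∧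
      Θ < pairAngle (sectorCenter J' (ω i₀)) (sectorCenter J' (ω j₀)) ∧
      ∃ kk : Fin (m + 1) → (Fin 2 → ℝ), (∀ i' : Fin (m + 1), kk i' ∈ sSector u klE0 J' (ω i' : ℕ)) ∧ ∑ i', kk i' = 0} with hStr
  have hfibre : ∀ t : Fin (m + 1) → Fin (sectorCount k),
      (((S.filter fun σ'' => f σ'' = t).card : ℕ) : ℝ) ≤ Nat.card (Str t) := by
    intro t
    set St := S.filter fun σ'' => f σ'' = t with hSt
    -- the map into the string set
    have hmem : ∀ σ'' ∈ St, Φ σ'' ∈ Str t := by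
      intro σ'' hσ''
      rw [hSt, mem_filter, hSdef, mem_filter] at hσ''
      obtain ⟨⟨hAmem, hE, hleg⟩, hft⟩ := hσ''
      rw [hStr]
      refine ⟨?_, ?_, ?_, ?_, ?_⟩
      · -- the prescribed legs
        intro e he
        have := hE e he
        apply Fin.ext
        show hti J' (decide ((σ'' e).2 = 0)) ((σ'' e).1.1 : ℕ) = hti J' (decide ((τ'' e).2 = 0)) ((τ'' e).1.1 : ℕ)
        rw [this]
      · -- nesting of the other legs in their ancestors
        intro i _
        have hti_eq : ((t i : Fin (sectorCount k)) : ℕ) = ((Φ σ'' i : Fin (sectorCount J')) : ℕ) / 2 ^ (J' - k) := by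
          rw [← hft]
        have hsub := sSector2003_subset_of_le u he0.le hkJ ((Φ σ'' i : Fin (sectorCount J')) : ℕ)
        rw [← hti_eq] at hsub
        exact hsub
      · -- the fine wedge from the coarse one: each fine chart centre is within `(5/2)·w_k` of the sign-absorbed coarse centre
        intro p hp m' hm'
        have hnear : ∀ i, FermiRG.torusDist (sectorCenter J' (Φ σ'' i) -
            sectorCenter k (if (σ' i).2 = 0 then ((σ' i).1.1 : ℕ) else
              if ((σ' i).1.1 : ℕ) < 2 ^ k then ((σ' i).1.1 : ℕ) + 2 ^ k else ((σ' i).1.1 : ℕ) - 2 ^ k)) ≤ 5 / 2 * sectorWidth k := by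
          intro i
          obtain ⟨⟨q, hq, hq'⟩, -, hch⟩ := hleg i
          obtain ⟨D, hDabs, hDdvd⟩ := exists_ancestor_near_of_overlap L M he0 hkJ hq hq'
          have h := torusDist_fineCentre_sub_coarseCentre_le hkJ (decide ((σ'' i).2 = 0)) (σ'' i).1.1.isLt (σ' i).1.1.isLt hDabs hDdvd
          have e1 : sectorCenter J' (Φ σ'' i) =
              sectorCenter J' (if decide ((σ'' i).2 = 0) then ((σ'' i).1.1 : ℕ) else
                if ((σ'' i).1.1 : ℕ) < 2 ^ J' then ((σ'' i).1.1 : ℕ) + 2 ^ J' else ((σ'' i).1.1 : ℕ) - 2 ^ J') := by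
            simp only [hΦ, hhti]
          have e2 : (if (σ' i).2 = 0 then ((σ' i).1.1 : ℕ) else
                if ((σ' i).1.1 : ℕ) < 2 ^ k then ((σ' i).1.1 : ℕ) + 2 ^ k else ((σ' i).1.1 : ℕ) - 2 ^ k) =
              (if decide ((σ'' i).2 = 0) then ((σ' i).1.1 : ℕ) else
                if ((σ' i).1.1 : ℕ) < 2 ^ k then ((σ' i).1.1 : ℕ) + 2 ^ k else ((σ' i).1.1 : ℕ) - 2 ^ k) := by
            rw [hch]
            by_cases h0 : (σ'' i).2 = 0
            · rw [if_pos h0, decide_eq_true h0, if_pos rfl]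
            · rw [if_neg h0, decide_eq_false h0, if_neg Bool.false_ne_true]
          rw [e1, e2]
          exact h
        calc pairAngle (sectorCenter J' (Φ σ'' p)) (sectorCenter J' (Φ σ'' m'))
            ≤ pairAngle
                (sectorCenter k (if (σ' p).2 = 0 then ((σ' p).1.1 : ℕ) else
                  if ((σ' p).1.1 : ℕ) < 2 ^ k then ((σ' p).1.1 : ℕ) + 2 ^ k else ((σ' p).1.1 : ℕ) - 2 ^ k))
                (sectorCenter k (if (σ' m').2 = 0 then ((σ' m').1.1 : ℕ) else
                  if ((σ' m').1.1 : ℕ) < 2 ^ k then ((σ' m').1.1 : ℕ) + 2 ^ k else ((σ' m').1.1 : ℕ) - 2 ^ k)) +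
              FermiRG.torusDist (sectorCenter J' (Φ σ'' p) -
                sectorCenter k (if (σ' p).2 = 0 then ((σ' p).1.1 : ℕ) else
                  if ((σ' p).1.1 : ℕ) < 2 ^ k then ((σ' p).1.1 : ℕ) + 2 ^ k else ((σ' p).1.1 : ℕ) - 2 ^ k)) +
              FermiRG.torusDist (sectorCenter J' (Φ σ'' m') -
                sectorCenter k (if (σ' m').2 = 0 then ((σ' m').1.1 : ℕ) else
                  if ((σ' m').1.1 : ℕ) < 2 ^ k then ((σ' m').1.1 : ℕ) + 2 ^ k else ((σ' m').1.1 : ℕ) - 2 ^ k)) :=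
              pairAngle_le_add_torusDist_two _ _ _ _
          _ ≤ Ψ₀ + 5 / 2 * sectorWidth k + 5 / 2 * sectorWidth k := add_le_add_three (hwedge p hp m' hm') (hnear p) (hnear m')
          _ = Ψ₀ + 5 * sectorWidth k := by ring
      · -- the wide pair: fine centres within `(5/2)·w_k` of the coarse ones, so the fine angle exceeds `Θ`
        have hnear : ∀ i, FermiRG.torusDist (sectorCenter J' (Φ σ'' i) -
            sectorCenter k (if (σ' i).2 = 0 then ((σ' i).1.1 : ℕ) else
              if ((σ' i).1.1 : ℕ) < 2 ^ k then ((σ' i).1.1 : ℕ) + 2 ^ k else ((σ' i).1.1 : ℕ) - 2 ^ k)) ≤ 5 / 2 * sectorWidth k := by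
          intro i
          obtain ⟨⟨q, hq, hq'⟩, -, hch⟩ := hleg i
          obtain ⟨D, hDabs, hDdvd⟩ := exists_ancestor_near_of_overlap L M he0 hkJ hq hq'
          have h := torusDist_fineCentre_sub_coarseCentre_le hkJ (decide ((σ'' i).2 = 0)) (σ'' i).1.1.isLt (σ' i).1.1.isLt hDabs hDdvd
          have e1 : sectorCenter J' (Φ σ'' i) =
              sectorCenter J' (if decide ((σ'' i).2 = 0) then ((σ'' i).1.1 : ℕ) else
                if ((σ'' i).1.1 : ℕ) < 2 ^ J' then ((σ'' i).1.1 : ℕ) + 2 ^ J' else ((σ'' i).1.1 : ℕ) - 2 ^ J') := by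
            simp only [hΦ, hhti]
          have e2 : (if (σ' i).2 = 0 then ((σ' i).1.1 : ℕ) else
                if ((σ' i).1.1 : ℕ) < 2 ^ k then ((σ' i).1.1 : ℕ) + 2 ^ k else ((σ' i).1.1 : ℕ) - 2 ^ k) =
              (if decide ((σ'' i).2 = 0) then ((σ' i).1.1 : ℕ) else
                if ((σ' i).1.1 : ℕ) < 2 ^ k then ((σ' i).1.1 : ℕ) + 2 ^ k else ((σ' i).1.1 : ℕ) - 2 ^ k) := by
            rw [hch]
            by_cases h0 : (σ'' i).2 = 0
            · rw [if_pos h0, decide_eq_true h0, if_pos rfl]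
            · rw [if_neg h0, decide_eq_false h0, if_neg Bool.false_ne_true]
          rw [e1, e2]
          exact h
        -- `φ(coarse i₀, coarse j₀) ≤ φ(fine i₀, fine j₀) + d(fine i₀, coarse i₀) + d(fine j₀, coarse j₀)`
        have hrev := pairAngle_le_add_torusDist_two (sectorCenter J' (Φ σ'' i₀))
          (sectorCenter k (if (σ' i₀).2 = 0 then ((σ' i₀).1.1 : ℕ) else
            if ((σ' i₀).1.1 : ℕ) < 2 ^ k then ((σ' i₀).1.1 : ℕ) + 2 ^ k else ((σ' i₀).1.1 : ℕ) - 2 ^ k))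
          (sectorCenter J' (Φ σ'' j₀))
          (sectorCenter k (if (σ' j₀).2 = 0 then ((σ' j₀).1.1 : ℕ) else
            if ((σ' j₀).1.1 : ℕ) < 2 ^ k then ((σ' j₀).1.1 : ℕ) + 2 ^ k else ((σ' j₀).1.1 : ℕ) - 2 ^ k))
        have h1 := hnear i₀
        have h2 := hnear j₀
        rw [← torusDist_neg_eq, neg_sub] at h1 h2
        linarith
      · -- the momenta: supports → chart s-sectors, signs absorbed, conservation in `ℝ²` (target `0`) by the off-class splitter
        have hmemA := hA'' hAmem
        unfold bgmSectorSet at hmemA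
        rw [mem_filter] at hmemA
        obtain ⟨-, kf, hkF, hsum⟩ := hmemA
        refine ⟨fun i => if decide ((σ'' i).2 = 0) then torusCentredMomentum L (kf i).2 else -torusCentredMomentum L (kf i).2,
          fun i => ?_, ?_⟩
        · have hrep := rep_mem_sSector2003_of_klAnisoFamily B hA hADt L M he0 β J' hlo hhi (hkF i)
          exact signedMom_mem_sSector2003 he0.le hanti (decide ((σ'' i).2 = 0)) hrep
        · have hz := hsplit K A hA (hAκ.trans hκ1) μ hμ L M β m k J' hkJ σ' σ'' hleg hoff kf hkF hsum
          funext j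
          rw [Finset.sum_apply]
          have e : ∀ i, (if decide ((σ'' i).2 = 0) then torusCentredMomentum L (kf i).2
              else -torusCentredMomentum L (kf i).2) j =
              (if (σ'' i).2 = 0 then torusCentredMomentum L (kf i).2 j else -torusCentredMomentum L (kf i).2 j) := by
            intro i
            by_cases h : (σ'' i).2 = 0
            · rw [decide_eq_true h, if_pos rfl, if_pos h]
            · rw [decide_eq_false h, if_neg Bool.false_ne_true, if_neg h, Pi.neg_apply]
          simp only [e]
          exact hz j
    -- injectivity on the fibre: spins and charges are those of `σ′`, the half-turn map is injective per charge
    have hinj : Set.InjOn Φ (St : Set (Fin (m + 1) → SectorLeg (sectorCount J'))) := by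
      intro a ha b hb hab
      rw [Finset.mem_coe, hSt, mem_filter, hSdef, mem_filter] at ha hb
      funext i
      obtain ⟨-, haspin, hach⟩ := ha.1.2.2 i
      obtain ⟨-, hbspin, hbch⟩ := hb.1.2.2 i
      have hi := congrArg (fun g => ((g i : Fin (sectorCount J')) : ℕ)) hab
      simp only [hΦ, hhti] at hi
      rw [← hach, ← hbch] at hi
      have hω : ((a i).1.1 : ℕ) = ((b i).1.1 : ℕ) := halfTurnIdx_injOn _ (a i).1.1.isLt (b i).1.1.isLt hi
      exact Prod.ext (Prod.ext (Fin.ext hω) (haspin.symm.trans hbspin)) (hach.symm.trans hbch)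
    -- count
    have hc : St.card ≤ Nat.card (Str t) := by
      have h1 : Nat.card (St : Set (Fin (m + 1) → SectorLeg (sectorCount J'))) ≤ Nat.card (Str t) :=
        Nat.card_le_card_of_injective (fun x : (St : Set (Fin (m + 1) → SectorLeg (sectorCount J'))) =>
            (⟨Φ x.1, hmem x.1 x.2⟩ : Str t))
          (fun x y hxy => Subtype.ext (hinj x.2 y.2 (congrArg Subtype.val hxy)))
      rwa [Nat.card_coe_set_eq, Set.ncard_coe_finset] at h1
    exact_mod_cast hc
  -- (3) SUM OVER THE CANDIDATES
  have hLΨ' : LΨ = (m + 1 : ℕ) + c₂ * (E.card * (Ψ₀ + 5 * sectorWidth k)) / (K₁ * Θ) := hLΨ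
  have hcount' : ∀ t : Fin (m + 1) → Fin (sectorCount k),
      (Nat.card (Str t) : ℝ) ≤ (m + 1 : ℕ) ^ 2 * (Bfib * (3 * (2 : ℝ) ^ (J' - k)) ^ ((m + 1) - E.card - 2)) := by
    intro t
    have h := hcount K A hA (hAκ.trans hκ2) μ hμ k J' hkJ (m + 1) E hEL τc (fun i => (t i : ℕ)) (fun i => (t i).isLt)
      0 Θ (Ψ₀ + 5 * sectorWidth k) LΨ Bfib hΨ hLΨ' hΘt hΘδ hΘη hBfib i₀ j₀ hi₀ hj₀
    rw [hStr]
    exact h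
  have hsum : ((S.card : ℕ) : ℝ) = ∑ t ∈ (univ : Finset (Fin (m + 1) → Fin 5)).image T,
      (((S.filter fun σ'' => f σ'' = t).card : ℕ) : ℝ) := by
    exact_mod_cast card_eq_sum_card_fiberwise hcover
  calc ((S.card : ℕ) : ℝ) = ∑ t ∈ (univ : Finset (Fin (m + 1) → Fin 5)).image T,
        (((S.filter fun σ'' => f σ'' = t).card : ℕ) : ℝ) := hsum
    _ ≤ ∑ _t ∈ (univ : Finset (Fin (m + 1) → Fin 5)).image T, ((m + 1 : ℕ) : ℝ) ^ 2 * (Bfib * (3 * (2 : ℝ) ^ (J' - k)) ^ ((m + 1) - E.card - 2)) :=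
        sum_le_sum fun t _ => (hfibre t).trans (hcount' t)
    _ = (((univ : Finset (Fin (m + 1) → Fin 5)).image T).card : ℝ) * (((m + 1 : ℕ) : ℝ) ^ 2 * (Bfib * (3 * (2 : ℝ) ^ (J' - k)) ^ ((m + 1) - E.card - 2))) := by
        rw [sum_const, nsmul_eq_mul]
    _ ≤ (5 : ℝ) ^ (m + 1) * (((m + 1 : ℕ) : ℝ) ^ 2 * (Bfib * (3 * (2 : ℝ) ^ (J' - k)) ^ ((m + 1) - E.card - 2))) := by
        refine mul_le_mul_of_nonneg_right ?_ ?_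
        · have h1 : ((univ : Finset (Fin (m + 1) → Fin 5)).image T).card ≤ 5 ^ (m + 1) :=
            card_image_le.trans (by rw [card_univ, card_fun_fin_five])
          exact_mod_cast h1
        · have hB0 : 0 ≤ Bfib := le_trans (le_max_of_le_left (sq_nonneg _)) hBfib
          positivity


end Summit.HubbardSuperconductivity.HubbardSuperconductivity.Theorems.PerturbedFermiCurve

end
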